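import Summits.QuantumFields.YangMills.Theorems.IR.AfPincerUcTypChainPeierls
import Summits.QuantumFields.YangMills.Theorems.IR.AfPincerUcTypChainSupplier
import Summits.QuantumFields.YangMills.Theorems.IR.AfPincerUcTypChainSharpTolerance
import HarnessLib

/-!
# Crux `IR` (stmt-QuantumFields-19354), line `af-pincer-Uc`: the DEEP short-chain class `TypChainDeep` (1/2) — the LEAD's located
# re-cut candidate «TypChainDeep» TYPED, with its bookkeeping: cell-locality, measurability, insertion tolerance (R109 (3), sharp
# guard, own guard); sequel `AfPincerUcTypChainDeepReduced`: clauses (iii)/(ii) and the supplier targets (seat ym-19354-afpincer-s1 g3)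

Helper module for item `stmt-QuantumFields-19354` (`--supports stmt-QuantumFields-19354 --as helper`; it closes nothing; registry and
slot of record «sharp merge I♯_SC» `Cruxes/IR/Lines/af_pincer_Uc_sharp.lean` sha16 `28967a1bf60ad397` UNTOUCHED).

WHY.  The lane-A supplier statement of record for `stub_onsetSharpSC` instantiates the format's free `Typ` at the short-chain class
`SharpLanes.TypChain ρ θ w ℓ₀` (owner R112; `TypChainSharpSC`, reduced by the LEAD to `TypChainReducedAtSC` = clause (i) +
`KernelPlaqSparse`, p544202).  Two independent cooling probes of the θ-window's lower end (S1 g2 `FINDING-flux-adversary`, LEAD g3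
`FORCING-NUMERICS-g3`, evidence on the item) found that every measured forcing of a resampled cell's OWN plaquettes by
`TypChain`-typical exteriors lives in the BOUNDARY LAYER (depth `0`/`1`: face-interior ratio `< 1`, edge/corner overshoot for
`θ ≲ 0.36`, SU(2)), while plaquettes of depth `≥ 2` carry `≤ 0.03` of the exterior level in both probes.  The LEAD's closing line
(18:11Z, (B)(5)) located the re-cut candidate for the owner: «TypChainDeep» = the short-chain class READ ON INTERIOR PLAQUETTES OF DEPTH
`≥ 2` ONLY — cell-local and insertion tolerant as before, clause (iii) inherited by `clauseIII_of_subset`/`HasBadChainAmong.mono_set`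
(p549673), clause (i) unchanged in kind.  THIS FILE types that class with the depth as a parameter `D` and proves its bookkeeping, so
that the candidate is registrable∕citable BY NAME if the owner adopts it; nothing here changes the class of record.

A located remark of this seat on WHY a class re-cut (and not a `ζ`-measurable shell discount inside `KernelPlaqSparse`, R119 (3)(α))
is the coherent form of «do not charge the forced layer»: a `TypChain`-typical neighbour may carry a DENSE DUST of isolated bad
plaquettes in its layer adjacent to the charged cell (e.g. on the sublattice `3ℤ³` of that layer: no two within `ℓ∞`-distance `2`, so no
chain of positive extent at all, typical for every `ℓ₀ ≥ 1`), and the radius-`≥ 1` neighbourhood of such a dust covers the whole face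
layer of the charged cell; a discount exempting own plaquettes near exterior insults therefore exempts entire face layers, in which bad
chains of every extent fit — the Peierls count over `TypChain`'s chains cannot absorb it.  Reading the class itself off the depth-`≥ D`
core removes the face layers from BOTH sides of the count (they are neither charged nor read), which is what the numerics support.

CONTENTS (namespace `…Cruxes.IR.AfPincerUc.SharpLanes`, next to `TypChain`):
* §1 `deepSites w D c` (the cell's site box shrunk by `D` on every face), `deepPlaqs w D c ⊆ cellPlaqs w c` (own plaquettes with
  base point and both shifted corners in the shrunk box; `deepPlaqs w 0 c = cellPlaqs w c`; antitone in `D`).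
* §2 `TypChainDeep ρ θ w ℓ₀ D c := {U | ¬ HasBadChainAmong ρ θ (deepPlaqs w D c) ℓ₀ U}`; `TypChain ⊆ TypChainDeep`
  (`typChain_subset_typChainDeep`), `typChainDeep_zero : TypChainDeep … 0 = TypChain …`, monotonicity in `(θ, ℓ₀, D)`, `1 ∈ TypChainDeep`.
* §3 `TypLocal`: `noChainAmong_dependsOn` / `measurableSet_noChainAmong` for ANY plaquette sub-family of the cell (the `TypChain` proofs,
  generalised once), `typLocal_typChainDeep`.
* §4 R109 (3) for the deep class, SHARP guard and OWN-plaquette guard: `insertionTolerantOwn_noChainAmong_sharp` (any sub-family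
  `Pl c ⊆ cellPlaqs w c`; `θg < θb`, `R ≥ 3`, `3ℓ₁ ≤ ℓ₀ + 1`; nsc g3's loop-erasure-as-inequality proof verbatim up to the family),
  `insertionTolerant{Own,}_typChainDeep_sharp`, constants of record `insertionTolerant_typChainDeep_record` (`(ℓ₁, ℓ₀, R) = (6, ≥ 17, 3)`).
* SEQUEL `AfPincerUcTypChainDeepReduced` (2/2): clause (iii) for `TypChainDeep` INHERITED from `clauseIII_typChain` (same budget and
  extent, every depth); clause (ii) REDUCED BY NAME to `KernelPlaqSparseDeep` (kernel sparseness asked ONLY of plaquette sets inside the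
  depth-`D` cores of the charged cells, via S1 g2's hereditary Peierls bound with cells `deepPlaqs w D c`); the supplier targets
  `TypChainDeepSharpSC` ∕ `TypChainDeepReducedAtSC` and their compositions to I♯_SC and `IR` by name.

NOT done here or in the sequel: clause (i) for the deep class (weak-coupling mixing for collars typical in the deep sense — the crux
content, unchanged in kind) and the deep kernel sparseness itself (research-grade, p544202 docstring); the depth of record (`D = 2` in
the numerics) is the owner's∕supplier's to print.  HONEST FRAMING: a typed class and its
bookkeeping around ONE open stub of a CONDITIONAL chain (Track A 0/28 UV); nothing of weak-coupling mixing, asymptotic freedom or a gap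
is proved or claimed; not infinite volume, not Clay.  No `sorry`; axioms ⊆ {propext, Classical.choice, Quot.sound}; no instances, no notation.
-/

set_option autoImplicit false

noncomputable section

open MeasureTheory
open Literature.MathematicalPhysics.QuantumFieldTheory hiding ZdEdge
open Literature.MathematicalPhysics.QuantumLattice
open Literature.Probability.LatticeModels (Site)
open Summit.QuantumFields.YangMills.Cruxes.IR.Tempered (cellEdges)
open Summit.QuantumFields.YangMills.Theorems.OddTorusChessboard (cellPlaqs plaqAction cellSites mem_cellSites
  plaqAction_congr measurable_plaqAction plaquetteEdges_subset_of_mem_cellPlaqs card_cellPlaqs_le card_orient_four)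

namespace Summit.QuantumFields.YangMills.Cruxes.IR.AfPincerUc.SharpLanes

open Summit.QuantumFields.YangMills.Cruxes.IR.AfPincerUc

/-! ## §1 The depth-`D` core of a cell and its plaquettes -/
section Core

/-- **The depth-`D` core of the cell `c` of the frame `w`**: the cell's site box `∏ᵢ [w i (c i), w i (c i + 1))` shrunk by `D`
on every face, `∏ᵢ [w i (c i) + D, w i (c i + 1) − D)`.  Its sites are at `ℓ∞`-distance `≥ D + 1` from every site outside the cell
(LEAD's «layer `≥ D`»). -/
def deepSites (w : Fin 4 → ℤ → ℤ) (D : ℕ) (c : Fin 4 → ℤ) : Finset (Fin 4 → ℤ) :=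
  Fintype.piFinset fun i : Fin 4 => Finset.Ico (w i (c i) + (D : ℤ)) (w i (c i + 1) - (D : ℤ))

/-- Membership in the core. -/
theorem mem_deepSites {w : Fin 4 → ℤ → ℤ} {D : ℕ} {c : Fin 4 → ℤ} {x : Fin 4 → ℤ} :
    x ∈ deepSites w D c ↔ ∀ i, w i (c i) + (D : ℤ) ≤ x i ∧ x i < w i (c i + 1) - (D : ℤ) := by
  simp [deepSites, Fintype.mem_piFinset]

/-- The core lies in the cell. -/
theorem deepSites_subset_cellSites (w : Fin 4 → ℤ → ℤ) (D : ℕ) (c : Fin 4 → ℤ) : deepSites w D c ⊆ cellSites w c := by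
  intro x hx
  rw [mem_deepSites] at hx
  rw [mem_cellSites]
  intro i
  have h := hx i
  have hD : (0 : ℤ) ≤ (D : ℤ) := Nat.cast_nonneg D
  constructor <;> omega

/-- The core is antitone in the depth. -/
theorem deepSites_anti (w : Fin 4 → ℤ → ℤ) {D D' : ℕ} (hDD' : D ≤ D') (c : Fin 4 → ℤ) :
    deepSites w D' c ⊆ deepSites w D c := by
  intro x hx
  rw [mem_deepSites] at hx ⊢
  intro i
  have h := hx i
  have hD : (D : ℤ) ≤ (D' : ℤ) := by exact_mod_cast hDD'
  constructor <;> omega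

/-- Depth `0`: the core is the cell. -/
theorem deepSites_zero (w : Fin 4 → ℤ → ℤ) (c : Fin 4 → ℤ) : deepSites w 0 c = cellSites w c := by
  ext x
  rw [mem_deepSites, mem_cellSites]
  simp

/-- **The deep plaquettes of the cell**: own plaquettes (`cellPlaqs w c`) whose base point and both shifted corners `x + eᵢ`,
`x + eⱼ` lie in the depth-`D` core (hence all four corners do: the core is a box).  The boundary layers of depth `< D` are NOT read. -/
def deepPlaqs (w : Fin 4 → ℤ → ℤ) (D : ℕ) (c : Fin 4 → ℤ) : Finset (ZdPlaquette 4) :=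
  (cellPlaqs w c).filter fun q =>
    q.1 ∈ deepSites w D c ∧ q.1 + Pi.single q.2.1.1 1 ∈ deepSites w D c ∧ q.1 + Pi.single q.2.1.2 1 ∈ deepSites w D c

/-- Deep plaquettes are own plaquettes of the cell. -/
theorem deepPlaqs_subset (w : Fin 4 → ℤ → ℤ) (D : ℕ) (c : Fin 4 → ℤ) : deepPlaqs w D c ⊆ cellPlaqs w c :=
  Finset.filter_subset _ _

/-- Membership in `deepPlaqs`. -/
theorem mem_deepPlaqs {w : Fin 4 → ℤ → ℤ} {D : ℕ} {c : Fin 4 → ℤ} {q : ZdPlaquette 4} :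
    q ∈ deepPlaqs w D c ↔ q ∈ cellPlaqs w c ∧ q.1 ∈ deepSites w D c ∧
      q.1 + Pi.single q.2.1.1 1 ∈ deepSites w D c ∧ q.1 + Pi.single q.2.1.2 1 ∈ deepSites w D c :=
  Finset.mem_filter

/-- The deep plaquette set is antitone in the depth. -/
theorem deepPlaqs_anti (w : Fin 4 → ℤ → ℤ) {D D' : ℕ} (hDD' : D ≤ D') (c : Fin 4 → ℤ) :
    deepPlaqs w D' c ⊆ deepPlaqs w D c := by
  intro q hq
  rw [mem_deepPlaqs] at hq ⊢
  have hs := deepSites_anti w hDD' c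
  exact ⟨hq.1, hs hq.2.1, hs hq.2.2.1, hs hq.2.2.2⟩

/-- Depth `0`: every own plaquette is deep. -/
theorem deepPlaqs_zero (w : Fin 4 → ℤ → ℤ) (c : Fin 4 → ℤ) : deepPlaqs w 0 c = cellPlaqs w c := by
  unfold deepPlaqs
  refine Finset.filter_true_of_mem fun q hq => ?_
  rw [deepSites_zero]
  have h := Finset.mem_filter.1 hq
  exact ⟨(Finset.mem_product.1 h.1).1, h.2.1, h.2.2⟩

/-- A mesh-`b` frame's cell has at most `96 b⁴` deep plaquettes (crude: at most its own plaquettes). -/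
theorem card_deepPlaqs_le {b : ℕ} {w : Fin 4 → ℤ → ℤ} (hw : IsFrame b w) (D : ℕ) (c : Fin 4 → ℤ) :
    (deepPlaqs w D c).card ≤ 96 * b ^ 4 := by
  have h := card_cellPlaqs_le hw c
  rw [card_orient_four] at h
  calc (deepPlaqs w D c).card ≤ (cellPlaqs w c).card := Finset.card_le_card (deepPlaqs_subset w D c)
    _ ≤ (2 * b) ^ 4 * 6 := h
    _ = 96 * b ^ 4 := by ring

/-- Distinct cells of a mesh-`b` frame have disjoint deep plaquette sets. -/
theorem disjoint_deepPlaqs {b : ℕ} {w : Fin 4 → ℤ → ℤ} (hw : IsFrame b w) (D : ℕ) {c c' : Fin 4 → ℤ} (hcc : c ≠ c') :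
    Disjoint (deepPlaqs w D c) (deepPlaqs w D c') :=
  (disjoint_cellPlaqs hw hcc).mono (deepPlaqs_subset w D c) (deepPlaqs_subset w D c')

end Core

/-! ## §2 The deep short-chain class -/
section DeepClass

variable {G : Type} [Group G] {N : ℕ} (ρ : G →* Matrix (Fin N) (Fin N) ℂ)

/-- **`TypChainDeep` — the SHORT-CHAIN class of the cell READ ON ITS DEPTH-`D` CORE** (LEAD ym-lead-19354-af-pincer g3's located re-cut
candidate «TypChainDeep», depth of the numerics `D = 2`): NO `θ`-bad chain (steps `≤ 2` in `ℓ∞`) of extent `≥ ℓ₀` among the DEEP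
plaquettes `deepPlaqs w D c`.  Configurations with arbitrary boundary layers (depth `< D`) and any number of isolated short bad chains in
the core belong to it; `TypChainDeep … 0 = TypChain …` (`typChainDeep_zero`) and `TypChain ⊆ TypChainDeep` (`typChain_subset_typChainDeep`). -/
def TypChainDeep (θ : ℝ) (w : Fin 4 → ℤ → ℤ) (ℓ₀ D : ℕ) (c : Fin 4 → ℤ) : Set (LGConfig 4 G) :=
  {U | ¬ HasBadChainAmong ρ θ (↑(deepPlaqs w D c) : Set (ZdPlaquette 4)) ℓ₀ U}

variable {ρ}

/-- **`TypChain ⊆ TypChainDeep`**: a long bad chain among the deep plaquettes is one among the own plaquettes. -/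
theorem typChain_subset_typChainDeep (θ : ℝ) (w : Fin 4 → ℤ → ℤ) (ℓ₀ D : ℕ) (c : Fin 4 → ℤ) :
    TypChain ρ θ w ℓ₀ c ⊆ TypChainDeep ρ θ w ℓ₀ D c :=
  typChain_subset_noChainAmong (Finset.coe_subset.2 (deepPlaqs_subset w D c))

/-- Depth `0`: the deep class IS `TypChain`. -/
theorem typChainDeep_zero (θ : ℝ) (w : Fin 4 → ℤ → ℤ) (ℓ₀ : ℕ) (c : Fin 4 → ℤ) :
    TypChainDeep ρ θ w ℓ₀ 0 c = TypChain ρ θ w ℓ₀ c := by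
  rw [TypChainDeep, deepPlaqs_zero]
  rfl

/-- `TypChainDeep` is monotone: a larger badness threshold, a larger tolerated extent or a larger depth gives a larger class. -/
theorem typChainDeep_mono {θ θ' : ℝ} {w : Fin 4 → ℤ → ℤ} {ℓ₀ ℓ₀' D D' : ℕ} {c : Fin 4 → ℤ} (hθ : θ ≤ θ') (hℓ : ℓ₀ ≤ ℓ₀')
    (hD : D ≤ D') : TypChainDeep ρ θ w ℓ₀ D c ⊆ TypChainDeep ρ θ' w ℓ₀' D' c :=
  fun _ hU h => hU ((h.mono hθ hℓ).mono_set (Finset.coe_subset.2 (deepPlaqs_anti w hD c)))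

/-- Calibration: the trivial configuration has no bad plaquette at all for `θ > 0`, hence lies in every `TypChainDeep`. -/
theorem one_mem_typChainDeep {θ : ℝ} (hθ : 0 < θ) (w : Fin 4 → ℤ → ℤ) (ℓ₀ D : ℕ) (c : Fin 4 → ℤ) :
    (1 : LGConfig 4 G) ∈ TypChainDeep ρ θ w ℓ₀ D c :=
  typChain_subset_typChainDeep θ w ℓ₀ D c (one_mem_typChain ρ hθ w ℓ₀ c)

end DeepClass

/-! ## §3 Cell-locality and measurability (`TypLocal`), once for every plaquette sub-family of the cell -/
section Locality

variable {G : Type} [Group G] {N : ℕ} (ρ : G →* Matrix (Fin N) (Fin N) ℂ)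

/-- **The short-chain class over a sub-family of the cell's plaquettes is cell-local**: membership is read off the cell's own edges
(every plaquette of `cellPlaqs w c` has its four edges in `cellEdges w c`).  (`typChain_dependsOn`, generalised.) -/
theorem noChainAmong_dependsOn (θ : ℝ) {w : Fin 4 → ℤ → ℤ} {c : Fin 4 → ℤ} {Pl : Set (ZdPlaquette 4)}
    (hPl : Pl ⊆ ↑(cellPlaqs w c)) (ℓ : ℕ) :
    DependsOn (fun σ : LGConfig 4 G => σ ∈ {U | ¬ HasBadChainAmong ρ θ Pl ℓ U}) ↑(cellEdges w c) := by
  intro U V hUV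
  have hq : ∀ q ∈ Pl, plaqAction ρ q U = plaqAction ρ q V := by
    intro q hq
    exact plaqAction_congr ρ q fun e he =>
      hUV e (Finset.mem_coe.2 (plaquetteEdges_subset_of_mem_cellPlaqs (Finset.mem_coe.1 (hPl hq)) he))
  simp only [Set.mem_setOf_eq]
  exact propext ⟨fun hU hV => hU (hV.congr fun q hq' => (hq q hq').symm), fun hV hU => hV (hU.congr hq)⟩

/-- `TypChainDeep` is cell-local. -/
theorem typChainDeep_dependsOn (θ : ℝ) (w : Fin 4 → ℤ → ℤ) (ℓ₀ D : ℕ) (c : Fin 4 → ℤ) :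
    DependsOn (fun σ : LGConfig 4 G => σ ∈ TypChainDeep ρ θ w ℓ₀ D c) ↑(cellEdges w c) :=
  noChainAmong_dependsOn ρ θ (Finset.coe_subset.2 (deepPlaqs_subset w D c)) ℓ₀

variable [TopologicalSpace G] [IsTopologicalGroup G] [MeasurableSpace G] [BorelSpace G] [SecondCountableTopology G]

/-- **The short-chain class over ANY plaquette set is measurable** (for continuous `ρ`): its complement is a countable union, over chain
shapes, of finite intersections of the closed events `θ ≤ plaqAction ρ q ·`.  (`measurableSet_typChain`, generalised.) -/
theorem measurableSet_noChainAmong (hρ : Continuous ρ) (θ : ℝ) (Pl : Set (ZdPlaquette 4)) (ℓ : ℕ) :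
    MeasurableSet {U : LGConfig 4 G | ¬ HasBadChainAmong ρ θ Pl ℓ U} := by
  classical
  have hrepr : {U : LGConfig 4 G | ¬ HasBadChainAmong ρ θ Pl ℓ U} =
      (⋃ (k : ℕ), ⋃ (ch : Fin (k + 1) → ZdPlaquette 4),
        {U : LGConfig 4 G | (∀ i, ch i ∈ Pl) ∧ (∀ i, θ ≤ plaqAction ρ (ch i) U) ∧
          (∀ i : Fin k, supNormZ4 ((ch i.castSucc).1 - (ch i.succ).1) ≤ 2) ∧
            ℓ ≤ supNormZ4 ((ch 0).1 - (ch (Fin.last k)).1)})ᶜ := by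
    ext U
    simp only [HasBadChainAmong, Set.mem_setOf_eq, Set.mem_compl_iff, Set.mem_iUnion, not_exists]
  rw [hrepr]
  refine MeasurableSet.compl (MeasurableSet.iUnion fun k => MeasurableSet.iUnion fun ch => ?_)
  by_cases hA : (∀ i, ch i ∈ Pl) ∧
      (∀ i : Fin k, supNormZ4 ((ch i.castSucc).1 - (ch i.succ).1) ≤ 2) ∧ ℓ ≤ supNormZ4 ((ch 0).1 - (ch (Fin.last k)).1)
  · have hset : {U : LGConfig 4 G | (∀ i, ch i ∈ Pl) ∧
        (∀ i, θ ≤ plaqAction ρ (ch i) U) ∧ (∀ i : Fin k, supNormZ4 ((ch i.castSucc).1 - (ch i.succ).1) ≤ 2) ∧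
          ℓ ≤ supNormZ4 ((ch 0).1 - (ch (Fin.last k)).1)} = ⋂ i, {U | θ ≤ plaqAction ρ (ch i) U} := by
      ext U
      simp [hA]
    rw [hset]
    exact MeasurableSet.iInter fun i => measurableSet_le measurable_const (measurable_plaqAction ρ hρ _)
  · have hset : {U : LGConfig 4 G | (∀ i, ch i ∈ Pl) ∧
        (∀ i, θ ≤ plaqAction ρ (ch i) U) ∧ (∀ i : Fin k, supNormZ4 ((ch i.castSucc).1 - (ch i.succ).1) ≤ 2) ∧
          ℓ ≤ supNormZ4 ((ch 0).1 - (ch (Fin.last k)).1)} = ∅ := by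
      ext U
      simp only [Set.mem_setOf_eq, Set.mem_empty_iff_false, iff_false]
      rintro ⟨h1, -, h3, h4⟩
      exact hA ⟨h1, h3, h4⟩
    rw [hset]
    exact MeasurableSet.empty

/-- `TypChainDeep` is measurable (continuous `ρ`). -/
theorem measurableSet_typChainDeep (hρ : Continuous ρ) (θ : ℝ) (w : Fin 4 → ℤ → ℤ) (ℓ₀ D : ℕ) (c : Fin 4 → ℤ) :
    MeasurableSet (TypChainDeep ρ θ w ℓ₀ D c) :=
  measurableSet_noChainAmong ρ hρ θ _ ℓ₀

/-- **`TypChainDeep` is a `TypLocal` family** (the format's bookkeeping conjuncts), for continuous `ρ`. -/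
theorem typLocal_typChainDeep (hρ : Continuous ρ) (θ : ℝ) (w : Fin 4 → ℤ → ℤ) (ℓ₀ D : ℕ) :
    TypLocal w (TypChainDeep ρ θ w ℓ₀ D) :=
  ⟨fun c => measurableSet_typChainDeep ρ hρ θ w ℓ₀ D c, fun c => typChainDeep_dependsOn ρ θ w ℓ₀ D c⟩

end Locality

/-! ## §4 R109 (3) for the deep class: insertion tolerance, SHARP guard, OWN-plaquette guard -/
section Tolerance

variable {G : Type} [Group G] {N : ℕ} {ρ : G →* Matrix (Fin N) (Fin N) ℂ}

/-- **R109 (3), sharp guard, own-plaquette guard, for the short-chain class over ANY sub-family `Pl c ⊆ cellPlaqs w c` (PROVED).**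
For `θg < θb`, `R ≥ 3` and `3ℓ₁ ≤ ℓ₀ + 1` the family `c ↦ {U | no θb-bad chain of extent ≥ ℓ₀ among Pl c}` is
`(θg, R, ℓ₁)`-insertion tolerant with the OWN guard (`InsertionTolerantOwn`).  Proof = `insertionTolerant_typChain_sharp` (nsc g3)
verbatim: a chain plaquette off `P` keeps its `U`-action, so it is `θb`-bad in `U` and cannot sit in the `θg`-clean guard, where a
chain neighbour touching `P` would put it (`mem_guard_of_near_touching`, which only needs the chain plaquette to be an OWN plaquette);
hence the chain is all-off `P` (a chain of `U`: impossible) or all-on `P`, and then loop erasure over the `≤ ℓ₁` touched links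
(`dist_add_le_mul_card`, signed offsets `fst_sub_of_mem_plaquetteEdges`) bounds its extent by `3ℓ₁ − 2 < ℓ₀`. -/
theorem insertionTolerantOwn_noChainAmong_sharp {θg θb : ℝ} (hθ : θg < θb) (w : Fin 4 → ℤ → ℤ) {R ℓ₀ ℓ₁ : ℕ}
    (hR : 3 ≤ R) (hℓ : 3 * ℓ₁ ≤ ℓ₀ + 1) {Pl : (Fin 4 → ℤ) → Finset (ZdPlaquette 4)}
    (hPl : ∀ c, Pl c ⊆ cellPlaqs w c) :
    InsertionTolerantOwn ρ w θg R ℓ₁ (fun c => {U | ¬ HasBadChainAmong ρ θb (↑(Pl c) : Set (ZdPlaquette 4)) ℓ₀ U}) := by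
  classical
  intro c U hU P _hPc hPm hclean V hVU
  rintro ⟨k, q, hqin, hqbad, hqstep, hqext⟩
  have hin' : ∀ i, q i ∈ cellPlaqs w c := fun i => hPl c (Finset.mem_coe.1 (hqin i))
  -- (1) a chain plaquette off `P` is `θb`-bad in `U`
  have hbadU : ∀ i, ¬ (plaquetteEdges (q i) ∩ P).Nonempty → θb ≤ plaqAction ρ (q i) U := by
    intro i hi
    have h := hqbad i
    rwa [plaqAction_eq_of_not_touching ρ hVU hi] at h
  -- (2) no mixed pair at chain distance
  have hmix : ∀ i j : Fin (k + 1), supNormZ4 ((q i).1 - (q j).1) ≤ 2 →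
      (plaquetteEdges (q i) ∩ P).Nonempty → (plaquetteEdges (q j) ∩ P).Nonempty := by
    intro i j hij hi
    by_contra hj
    have hmem := mem_guard_of_near_touching (R := R) hR hi (hin' j) hij
    have h1 := hclean _ (hin' j) hmem
    have h2 := hbadU j hj
    linarith
  -- (3) all-or-none along the chain
  have hprop : ∀ n (hn : n < k + 1),
      ((plaquetteEdges (q 0) ∩ P).Nonempty ↔ (plaquetteEdges (q ⟨n, hn⟩) ∩ P).Nonempty) := by
    intro n
    induction n with
    | zero => intro hn; exact Iff.rfl
    | succ n ih =>
      intro hn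
      rw [ih (by omega)]
      have hs := hqstep ⟨n, by omega⟩
      exact ⟨hmix ⟨n, by omega⟩ ⟨n + 1, hn⟩ hs,
        hmix ⟨n + 1, hn⟩ ⟨n, by omega⟩ (by rw [supNormZ4_sub_comm]; exact hs)⟩
  by_cases h0 : (plaquetteEdges (q 0) ∩ P).Nonempty
  · -- ALL ON `P`: loop erasure over the touched links
    have hall : ∀ i, (plaquetteEdges (q i) ∩ P).Nonempty := fun i => (hprop i.1 i.2).1 h0
    have hf : ∀ i : Fin (k + 1), ∃ e, e ∈ plaquetteEdges (q i) ∧ e ∈ P := fun i => by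
      obtain ⟨e, he⟩ := hall i
      exact ⟨e, (Finset.mem_inter.1 he).1, (Finset.mem_inter.1 he).2⟩
    choose f hfq hfP using hf
    let g : ℕ → ZdEdge 4 := fun n => if h : n < k + 1 then f ⟨n, h⟩ else f 0
    have hg : ∀ n (h : n < k + 1), g n = f ⟨n, h⟩ := fun n h => dif_pos h
    have himg : ((Finset.range (k + 1)).image g).card ≤ ℓ₁ := by
      refine le_trans (Finset.card_le_card ?_) hPm
      intro e he
      obtain ⟨n, hn, rfl⟩ := Finset.mem_image.1 he
      rw [hg n (Finset.mem_range.1 hn)]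
      exact hfP _
    have hcoord : ∀ j : Fin 4, (((q 0).1 - (q (Fin.last k)).1) j).natAbs + 2 ≤ 3 * ℓ₁ := by
      intro j
      have key := dist_add_le_mul_card (fun e e' : ZdEdge 4 => |e.1 j - e'.1 j|) (fun x => by simp)
        (fun x y z => abs_sub_le _ _ _) (by norm_num : (0 : ℤ) ≤ 3) g k (fun n hn => by
          rw [hg n (by omega), hg (n + 1) (by omega)]
          have hs := (supNormZ4_sub_le_iff_abs.1 (hqstep ⟨n, hn⟩)) j
          have ho1 := fst_sub_of_mem_plaquetteEdges (hfq ⟨n, by omega⟩) j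
          have ho2 := fst_sub_of_mem_plaquetteEdges (hfq ⟨n + 1, by omega⟩) j
          simp only [Fin.castSucc_mk, Fin.succ_mk] at hs
          rw [abs_le] at hs ⊢
          constructor <;> omega)
      rw [hg 0 (by omega), hg k (by omega)] at key
      have ho1 := fst_sub_of_mem_plaquetteEdges (hfq 0) j
      have ho2 := fst_sub_of_mem_plaquetteEdges (hfq (Fin.last k)) j
      have hmz : ((((Finset.range (k + 1)).image g).card : ℕ) : ℤ) ≤ (ℓ₁ : ℤ) := by exact_mod_cast himg
      have hkey : |(f 0).1 j - (f (Fin.last k)).1 j| ≤ 3 * (ℓ₁ : ℤ) - 3 := by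
        have hk' : (⟨k, by omega⟩ : Fin (k + 1)) = Fin.last k := rfl
        have h0' : (⟨0, by omega⟩ : Fin (k + 1)) = 0 := rfl
        rw [hk', h0'] at key
        linarith
      have habs : (((((q 0).1 - (q (Fin.last k)).1) j).natAbs : ℕ) : ℤ) + 2 ≤ 3 * (ℓ₁ : ℤ) := by
        rw [Int.natCast_natAbs, Pi.sub_apply]
        suffices h : |(q 0).1 j - (q (Fin.last k)).1 j| ≤ 3 * (ℓ₁ : ℤ) - 2 by linarith
        rw [abs_le] at hkey ⊢
        constructor <;> linarith [hkey.1, hkey.2, ho1.1, ho1.2, ho2.1, ho2.2]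
      exact_mod_cast habs
    have hsup : supNormZ4 ((q 0).1 - (q (Fin.last k)).1) ≤ 3 * ℓ₁ - 2 :=
      supNormZ4_le_iff.2 fun j => by have := hcoord j; omega
    have h2 : 2 ≤ 3 * ℓ₁ := by have := hcoord 0; omega
    omega
  · -- ALL OFF `P`: the chain was already a chain of `U`
    have hnone : ∀ i, ¬ (plaquetteEdges (q i) ∩ P).Nonempty := fun i hi => h0 ((hprop i.1 i.2).2 hi)
    exact hU ⟨k, q, hqin, fun i => hbadU i (hnone i), hqstep, hqext⟩

/-- **R109 (3) for `TypChainDeep`, sharp guard, own-plaquette guard (PROVED)**: `θg < θb`, `R ≥ 3`, `3ℓ₁ ≤ ℓ₀ + 1`, every depth `D`. -/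
theorem insertionTolerantOwn_typChainDeep_sharp {θg θb : ℝ} (hθ : θg < θb) (w : Fin 4 → ℤ → ℤ) {R ℓ₀ ℓ₁ : ℕ}
    (hR : 3 ≤ R) (hℓ : 3 * ℓ₁ ≤ ℓ₀ + 1) (D : ℕ) :
    InsertionTolerantOwn ρ w θg R ℓ₁ (TypChainDeep ρ θb w ℓ₀ D) :=
  insertionTolerantOwn_noChainAmong_sharp hθ w hR hℓ fun c => deepPlaqs_subset w D c

/-- **R109 (3) for `TypChainDeep` in the reading of record `InsertionTolerant` (PROVED)** — from the own-guard form. -/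
theorem insertionTolerant_typChainDeep_sharp {θg θb : ℝ} (hθ : θg < θb) (w : Fin 4 → ℤ → ℤ) {R ℓ₀ ℓ₁ : ℕ}
    (hR : 3 ≤ R) (hℓ : 3 * ℓ₁ ≤ ℓ₀ + 1) (D : ℕ) :
    InsertionTolerant ρ w θg R ℓ₁ (TypChainDeep ρ θb w ℓ₀ D) :=
  InsertionTolerant.of_own (insertionTolerantOwn_typChainDeep_sharp hθ w hR hℓ D)

/-- **Constants of record (R109 (4) ∕ nsc g3 `insertionTolerant_typChain_record`) for the deep class**: `ℓ₁ = 6` tolerated insertions,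
radius `R = 3`, any extent `ℓ₀ ≥ 17`, every `θg < θb`, every depth `D`. -/
theorem insertionTolerant_typChainDeep_record {θg θb : ℝ} (hθ : θg < θb) (w : Fin 4 → ℤ → ℤ) {ℓ₀ : ℕ} (hℓ : 17 ≤ ℓ₀)
    (D : ℕ) : InsertionTolerant ρ w θg 3 6 (TypChainDeep ρ θb w ℓ₀ D) :=
  insertionTolerant_typChainDeep_sharp hθ w le_rfl (by omega) D

end Tolerance

end Summit.QuantumFields.YangMills.Cruxes.IR.AfPincerUc.SharpLanes

end
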